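import Mathlib.Data.ZMod.Basic
import Mathlib.Algebra.CharP.Two
import Mathlib.Algebra.BigOperators.Ring.Finset
import Mathlib.Data.Finset.SymmDiff
import Literature.Computability.MetaComplexity.PigeonholeResLinTreeLike
import HarnessLib

/-!
# Parity constraints on linear orders (Gryaznov 2019, Lemma 3.4; Gryaznov–Ovcharov–Riazanov 2024, Lemma 3)

The combinatorial core of the tree-like Res(⊕) lower bound for the ORDERING PRINCIPLE
(`OrderingResLinTreeLike.lean`). A linear order on a finite ground set `S ⊆ ℕ` is recorded by a
RANKING `r : ℕ → ℕ` injective on `S` (`x ≺ y` iff `r x < r y`); the propositional variable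
`x_{kl}` ("`k ≺ l`") of the ordering principle takes the value `cmpBit r (k, l) = [r k < r l]`, and a
linear form over `𝔽₂` in these variables is a finite set `T` of ordered pairs, with value
`pairParity r T = Σ_{p ∈ T} [r p.1 < r p.2] ∈ 𝔽₂`.

* **Main lemma** (`OrderParity.exists_ranking_lt`) [Gryaznov 2019, Lemma 3.4 = GOR 2024, Lemma 3,
  in ranking language]: if `|S| ≥ 2` and `Φ` is a list of at most `|S| - 2` forms on off-diagonal
  pairs of `S`, then for every ranking `r` and every `i ∈ S` there is a ranking `r'` giving EVERY form
  of `Φ` the same parity as `r` does and in which `i` is NOT the minimum. (So every linear system with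
  `≤ n - 2` equations satisfied by some linear order is satisfied by a linear order with a different
  minimum.)
* Proof as printed (induction on `|S|`, `OrderParity.exists_ranking_lt_of_ascending`): orient every
  pair upwards w.r.t. `r` (`orient`, parities shift by a constant); if no pair occurs, move any other
  element to the bottom; if every occurring pair starts at the minimum `m`, the forms are vectors
  indexed by `S ∖ {m}` and a nonempty set `U` of even parity on all of them exists
  (`exists_nonempty_even_subset`, pigeonhole on parity patterns) — put `U` below `m`; otherwise pick
  an occurring pair `(i, j)`, `i ≠ m`, with `r j - r i` minimal (so no other occurring pair lies
  inside the interval `[i, j]`), make `(i, j)` occur in one form `T₀` only (add `T₀` to the others),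
  GLUE `j` into `i` in the remaining forms (odd-fibre image `parityImage (gluePair i j)`), apply the
  induction hypothesis on `S ∖ {j}`, and re-insert `j` immediately after (`liftAfter`) or before
  (`liftBefore`) `i`: both lifts solve the glued forms, and exactly one of them solves `T₀`.

Differences from print: forms are SETS of ordered pairs with parities compared to those of `r` (no
right-hand sides; junk variables are handled in the CNF bridge); "gluing" must cancel pairs that
become equal, hence the odd-fibre image; the choice "`i` maximal" of the printed proof is replaced by
"`(i, j)` with `i ≠ m` of minimal length", which gives the interval property directly.

## References

* S. Gryaznov, *Notes on resolution over linear equations*, CSR 2019, LNCS 11532, §3.2, Lemma 3.4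
  ("at most `n - 2` equations"), Theorem 3.5 [Gryaznov2019].
* S. Gryaznov, S. Ovcharov, A. Riazanov, *Resolution over linear equations: combinatorial games for
  tree-like size and space*, ACM Trans. Comput. Theory 16(3) (2024) = arXiv:2404.08370, §3.1.2,
  Lemma 3, Theorem 4 [GryaznovOvcharovRiazanov2024].
-/

namespace Literature.Computability.MetaComplexity

namespace OrderParity

open Finset

/-! ### Rankings, comparison bits and parities of sets of ordered pairs -/

/-- The comparison bit of the ordered pair `p = (k, l)` under the ranking `r`: `1` if `r k < r l`
(“`k ≺ l`”), else `0` — the value of the variable `x_{kl}` of the ordering principle in the linear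
order recorded by `r`. [Gryaznov–Ovcharov–Riazanov 2024, §3.1.2 ("`x_{ij}` states that the `i`th
element is less than the `j`th")] [cite: GryaznovOvcharovRiazanov2024, §3.1.2] -/
def cmpBit (r : ℕ → ℕ) (p : ℕ × ℕ) : ZMod 2 :=
  if r p.1 < r p.2 then 1 else 0

/-- The parity `Σ_{p ∈ T} [r p.1 < r p.2] ∈ 𝔽₂` of a set `T` of ordered pairs under the ranking `r`:
the value of the linear form `Σ_{(k,l) ∈ T} x_{kl}` on the linear order recorded by `r`.
[Gryaznov–Ovcharov–Riazanov 2024, Lemma 3 (proof: the system `Ax = b` evaluated on orders)]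
[cite: GryaznovOvcharovRiazanov2024, Lemma 3] -/
def pairParity (r : ℕ → ℕ) (T : Finset (ℕ × ℕ)) : ZMod 2 :=
  ∑ p ∈ T, cmpBit r p

/-- In `𝔽₂`, two distinct elements differ by `1`. [folklore] -/
theorem zmod2_eq_add_one_of_ne {a b : ZMod 2} (h : a ≠ b) : a = b + 1 := by
  revert h; revert a b; decide

/-- Parities add under symmetric difference of forms (row addition over `𝔽₂`).
[Gryaznov–Ovcharov–Riazanov 2024, Lemma 3 (proof: "add it to the other ones")] [folklore] -/
theorem pairParity_symmDiff (r : ℕ → ℕ) (T U : Finset (ℕ × ℕ)) :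
    pairParity r (symmDiff T U) = pairParity r T + pairParity r U := by
  unfold pairParity
  have hT := Finset.sum_inter_add_sum_sdiff T U (cmpBit r)
  have hU := Finset.sum_inter_add_sum_sdiff U T (cmpBit r)
  have hsd : symmDiff T U = T \ U ∪ U \ T := symmDiff_def T U
  rw [hsd, Finset.sum_union disjoint_sdiff_sdiff, ← hT, ← hU, Finset.inter_comm U T]
  set c := ∑ x ∈ T ∩ U, cmpBit r x
  calc ∑ x ∈ T \ U, cmpBit r x + ∑ x ∈ U \ T, cmpBit r x
      = (∑ x ∈ T \ U, cmpBit r x + ∑ x ∈ U \ T, cmpBit r x) + (c + c) := by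
        rw [CharTwo.add_self_eq_zero, add_zero]
    _ = c + ∑ x ∈ T \ U, cmpBit r x + (c + ∑ x ∈ U \ T, cmpBit r x) := by ring

/-- Reversing a pair flips its comparison bit, for a ranking injective on the ground set.
[Gryaznov–Ovcharov–Riazanov 2024, Lemma 3 (proof: "replace `x_{ji}` with `1 - x_{ij}`")]
[cite: GryaznovOvcharovRiazanov2024, Lemma 3] -/
theorem cmpBit_swap {ρ : ℕ → ℕ} {S : Finset ℕ} (hρ : Set.InjOn ρ S) {p : ℕ × ℕ} (h1 : p.1 ∈ S)
    (h2 : p.2 ∈ S) (hne : p.1 ≠ p.2) : cmpBit ρ p.swap = cmpBit ρ p + 1 := by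
  have hne' : ρ p.1 ≠ ρ p.2 := fun h => hne (hρ h1 h2 h)
  unfold cmpBit
  simp only [Prod.fst_swap, Prod.snd_swap]
  by_cases h : ρ p.1 < ρ p.2
  · rw [if_pos h, if_neg (not_lt.2 h.le)]; decide
  · rw [if_neg h, if_pos (lt_of_le_of_ne (not_lt.1 h) (Ne.symm hne'))]; simp

/-! ### The odd-fibre image of a form under a map of pairs -/

/-- The ODD-FIBRE image of a finite set `T` under `G`: the points of the image with an odd number of
preimages in `T` — the push-forward of the `𝔽₂`-vector `T` along `G` (pairs that are identified
cancel in pairs). [Gryaznov–Ovcharov–Riazanov 2024, Lemma 3 (proof: "syntactically replacing all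
the occurrences of `j` by `i`")] [folklore] -/
def parityImage {α β : Type*} [DecidableEq β] (G : α → β) (T : Finset α) : Finset β :=
  (T.image G).filter fun q => (T.filter fun p => G p = q).card % 2 = 1

/-- A point of the odd-fibre image has a preimage. [folklore] -/
theorem exists_of_mem_parityImage {α β : Type*} [DecidableEq β] {G : α → β} {T : Finset α} {q : β}
    (hq : q ∈ parityImage G T) : ∃ p ∈ T, G p = q := by
  unfold parityImage at hq
  exact Finset.mem_image.1 (Finset.mem_filter.1 hq).1

/-- **Push-forward of parities**: summing an `𝔽₂`-valued function over the odd-fibre image of `T` is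
summing its pull-back over `T`. [folklore] -/
theorem sum_parityImage {α β : Type*} [DecidableEq β] (G : α → β) (T : Finset α) (f : β → ZMod 2) :
    ∑ q ∈ parityImage G T, f q = ∑ p ∈ T, f (G p) := by
  classical
  unfold parityImage
  rw [Finset.sum_filter, ← Finset.sum_fiberwise_of_maps_to (s := T) (t := T.image G) (g := G)
    (fun p hp => Finset.mem_image_of_mem G hp) (fun p => f (G p))]
  refine Finset.sum_congr rfl fun q _ => ?_
  have h1 : ∑ p ∈ T with G p = q, f (G p) = ∑ p ∈ T with G p = q, f q :=
    Finset.sum_congr rfl fun p hp => by rw [(Finset.mem_filter.1 hp).2]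
  rw [h1, Finset.sum_const, nsmul_eq_mul]
  set c := (T.filter fun p => G p = q).card
  have hc : (c : ZMod 2) = ((c % 2 : ℕ) : ZMod 2) := (ZMod.natCast_mod c 2).symm
  rcases Nat.mod_two_eq_zero_or_one c with h | h
  · rw [hc, h, if_neg (by omega)]; simp
  · rw [hc, h, if_pos rfl]; simp

/-! ### Orientation: all pairs upwards -/

/-- Orient a pair upwards w.r.t. the ranking `r`. [Gryaznov–Ovcharov–Riazanov 2024, Lemma 3 (proof:
"replace all occurrences of `x_{ji}`, where `j ≻ i`, with `1 - x_{ij}`")]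
[cite: GryaznovOvcharovRiazanov2024, Lemma 3] -/
def orient (r : ℕ → ℕ) (p : ℕ × ℕ) : ℕ × ℕ :=
  if r p.1 < r p.2 then p else p.swap

/-- After orientation every pair of a form on off-diagonal pairs of `S` is ascending.
[Gryaznov–Ovcharov–Riazanov 2024, Lemma 3 (proof)] [cite: GryaznovOvcharovRiazanov2024, Lemma 3] -/
theorem ascending_of_mem_parityImage_orient {r : ℕ → ℕ} {S : Finset ℕ} (hr : Set.InjOn r S)
    {T : Finset (ℕ × ℕ)} (hT : ∀ p ∈ T, p.1 ∈ S ∧ p.2 ∈ S ∧ p.1 ≠ p.2) {q : ℕ × ℕ}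
    (hq : q ∈ parityImage (orient r) T) : q.1 ∈ S ∧ q.2 ∈ S ∧ r q.1 < r q.2 := by
  obtain ⟨p, hp, rfl⟩ := exists_of_mem_parityImage hq
  obtain ⟨h1, h2, hne⟩ := hT p hp
  unfold orient
  by_cases h : r p.1 < r p.2
  · rw [if_pos h]; exact ⟨h1, h2, h⟩
  · rw [if_neg h]
    exact ⟨h2, h1, lt_of_le_of_ne (not_lt.1 h) fun heq => hne (hr h1 h2 heq.symm)⟩

/-- Orientation shifts the parity of a form by a constant NOT depending on the (injective) ranking
it is evaluated at. [Gryaznov–Ovcharov–Riazanov 2024, Lemma 3 (proof: "this operation is safe")]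
[cite: GryaznovOvcharovRiazanov2024, Lemma 3] -/
theorem pairParity_parityImage_orient {r ρ : ℕ → ℕ} {S : Finset ℕ} (hρ : Set.InjOn ρ S)
    {T : Finset (ℕ × ℕ)} (hT : ∀ p ∈ T, p.1 ∈ S ∧ p.2 ∈ S ∧ p.1 ≠ p.2) :
    pairParity ρ (parityImage (orient r) T) =
      pairParity ρ T + ∑ p ∈ T, (if r p.1 < r p.2 then (0 : ZMod 2) else 1) := by
  unfold pairParity
  rw [sum_parityImage, ← Finset.sum_add_distrib]
  refine Finset.sum_congr rfl fun p hp => ?_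
  obtain ⟨h1, h2, hne⟩ := hT p hp
  unfold orient
  by_cases h : r p.1 < r p.2
  · rw [if_pos h, if_pos h, add_zero]
  · rw [if_neg h, if_neg h, cmpBit_swap hρ h1 h2 hne]

/-! ### Case 0: no pair occurs -/

/-- If no pair occurs in the system, any element `x ≠ m` can be moved to the bottom.
[Gryaznov–Ovcharov–Riazanov 2024, Lemma 3 (proof, base case: "the system `Ax = b` is empty")]
[cite: GryaznovOvcharovRiazanov2024, Lemma 3] -/
theorem exists_ranking_lt_of_forall_eq_empty {S : Finset ℕ} {r : ℕ → ℕ} (hr : Set.InjOn r S)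
    {m : ℕ} (hS : 1 < S.card) {Φ : List (Finset (ℕ × ℕ))} (h0 : ∀ T ∈ Φ, T = ∅) :
    ∃ r' : ℕ → ℕ, Set.InjOn r' S ∧ (∀ T ∈ Φ, pairParity r' T = pairParity r T) ∧
      ∃ x ∈ S, r' x < r' m := by
  classical
  obtain ⟨x, hxS, hxm⟩ := Finset.exists_mem_ne hS m
  refine ⟨fun y => if y = x then 0 else r y + 1, ?_, ?_, x, hxS, ?_⟩
  · intro y hy y' hy' h
    dsimp only at h
    by_cases hyx : y = x <;> by_cases hy'x : y' = x
    · rw [hyx, hy'x]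
    · rw [if_pos hyx, if_neg hy'x] at h; omega
    · rw [if_neg hyx, if_pos hy'x] at h; omega
    · rw [if_neg hyx, if_neg hy'x] at h; exact hr hy hy' (by omega)
  · intro T hT; rw [h0 T hT]; rfl
  · dsimp only; rw [if_pos rfl, if_neg (Ne.symm hxm)]; omega

/-! ### Case A: every occurring pair starts at the minimum -/

/-- **The star case** [Gryaznov–Ovcharov–Riazanov 2024, Lemma 3 (proof, case `i = 1`: "only
variables `x_{12}, …, x_{1n}` appear … the system must have another solution `τ'` … the element `1`
in `τ` cannot be the minimum")]: if every occurring pair is `(m, l)` with `m ≺ l`, a nonempty set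
`U ⊆ S ∖ {m}` of even parity on every form exists (more columns than equations), and putting `U`
below `m` keeps all parities. [cite: GryaznovOvcharovRiazanov2024, Lemma 3] -/
theorem exists_ranking_lt_of_star {S : Finset ℕ} {r : ℕ → ℕ} (hr : Set.InjOn r S) {m : ℕ}
    (hm : m ∈ S) {Φ : List (Finset (ℕ × ℕ))} (hlen : Φ.length + 2 ≤ S.card)
    (hΦ : ∀ T ∈ Φ, ∀ p ∈ T, p.1 = m ∧ p.2 ∈ S ∧ r m < r p.2) :
    ∃ r' : ℕ → ℕ, Set.InjOn r' S ∧ (∀ T ∈ Φ, pairParity r' T = pairParity r T) ∧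
      ∃ x ∈ S, r' x < r' m := by
  classical
  -- a nonempty set `U ⊆ S ∖ {m}` of even parity on every form (pigeonhole on parity patterns)
  set Φlin : List LinLit := Φ.map fun T => (T.image Prod.snd, false) with hΦlin
  have hlenI : Φlin.length < (S.erase m).card := by
    rw [hΦlin, List.length_map, Finset.card_erase_of_mem hm]; omega
  obtain ⟨U, hUI, hUne, hUeven⟩ := exists_nonempty_even_subset (S.erase m) Φlin hlenI
  have hmU : m ∉ U := fun h => Finset.notMem_erase m S (hUI h)
  have hUS : ∀ u ∈ U, u ∈ S := fun u hu => Finset.mem_of_mem_erase (hUI hu)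
  -- the bound `B` exceeds every rank
  set B : ℕ := S.sup r + 1 with hB
  have hltB : ∀ y ∈ S, r y < B := fun y hy => Nat.lt_succ_of_le (Finset.le_sup hy)
  refine ⟨fun y => if y ∈ U then r y else r y + B, ?_, ?_, ?_⟩
  · -- injective on `S`
    intro y hy y' hy' h
    dsimp only at h
    by_cases hyU : y ∈ U <;> by_cases hy'U : y' ∈ U
    · rw [if_pos hyU, if_pos hy'U] at h; exact hr hy hy' h
    · rw [if_pos hyU, if_neg hy'U] at h; have := hltB y hy; omega
    · rw [if_neg hyU, if_pos hy'U] at h; have := hltB y' hy'; omega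
    · rw [if_neg hyU, if_neg hy'U] at h; exact hr hy hy' (by omega)
  · -- parities: on `T` the new bits are `[p.2 ∉ U]`, the old ones are `1`, and `U` is even on `T`
    intro T hT
    have hbit' : ∀ p ∈ T, cmpBit (fun y => if y ∈ U then r y else r y + B) p =
        1 + (if p.2 ∈ U then 1 else 0) := by
      intro p hp
      obtain ⟨hp1, hp2, hlt⟩ := hΦ T hT p hp
      unfold cmpBit
      simp only [hp1, if_neg hmU]
      by_cases h2U : p.2 ∈ U
      · rw [if_pos h2U, if_pos h2U, if_neg (by have := hltB p.2 hp2; omega)]; decide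
      · rw [if_neg h2U, if_neg h2U, if_pos (by omega), add_zero]
    have hbit : ∀ p ∈ T, cmpBit r p = 1 := by
      intro p hp
      obtain ⟨hp1, -, hlt⟩ := hΦ T hT p hp
      unfold cmpBit; rw [hp1, if_pos hlt]
    have heven : ∑ p ∈ T, (if p.2 ∈ U then (1 : ZMod 2) else 0) = 0 := by
      have hinj : ∀ p ∈ T, ∀ p' ∈ T, p.2 = p'.2 → p = p' := by
        intro p hp p' hp' h
        exact Prod.ext (by rw [(hΦ T hT p hp).1, (hΦ T hT p' hp').1]) h
      have h1 := hUeven (T.image Prod.snd, false)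
        (by rw [hΦlin, List.mem_map]; exact ⟨T, hT, rfl⟩)
      simp only [parityIn] at h1
      rwa [Finset.sum_image hinj] at h1
    unfold pairParity
    rw [Finset.sum_congr rfl hbit', Finset.sum_congr rfl hbit, Finset.sum_add_distrib, heven, add_zero]
  · -- the new minimum lies in `U`
    obtain ⟨u, hu⟩ := hUne
    refine ⟨u, hUS u hu, ?_⟩
    dsimp only
    rw [if_pos hu, if_neg hmU]
    have := hltB u (hUS u hu); omega

/-! ### Case B: gluing `j` into `i`, and the two lifts -/

/-- Glue `j` into `i`. [Gryaznov–Ovcharov–Riazanov 2024, Lemma 3 (proof: "we 'glue' the elements `i`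
and `j` together")] [cite: GryaznovOvcharovRiazanov2024, Lemma 3] -/
def glue (i j : ℕ) (y : ℕ) : ℕ :=
  if y = j then i else y

/-- Glue `j` into `i` in an ordered pair (replace every occurrence of `j` by `i`).
[Gryaznov–Ovcharov–Riazanov 2024, Lemma 3 (proof: "syntactically replacing all the occurrences of
`j` by `i`")] [cite: GryaznovOvcharovRiazanov2024, Lemma 3] -/
def gluePair (i j : ℕ) (p : ℕ × ℕ) : ℕ × ℕ :=
  (glue i j p.1, glue i j p.2)

/-- The lift placing `j` IMMEDIATELY AFTER `i` in the order recorded by `r₁` on `S ∖ {j}`.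
[Gryaznov–Ovcharov–Riazanov 2024, Lemma 3 (proof: the order `… ≺ i ≺ j ≺ …`, display (1))]
[cite: GryaznovOvcharovRiazanov2024, Lemma 3] -/
def liftAfter (r₁ : ℕ → ℕ) (i j : ℕ) (y : ℕ) : ℕ :=
  if y = j then 2 * r₁ i + 1 else 2 * r₁ y

/-- The lift placing `j` IMMEDIATELY BEFORE `i` in the order recorded by `r₁` on `S ∖ {j}`.
[Gryaznov–Ovcharov–Riazanov 2024, Lemma 3 (proof: the order `… ≺ j ≺ i ≺ …`, display (2))]
[cite: GryaznovOvcharovRiazanov2024, Lemma 3] -/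
def liftBefore (r₁ : ℕ → ℕ) (i j : ℕ) (y : ℕ) : ℕ :=
  if y = j then 2 * r₁ i else 2 * r₁ y + 1

/-- Gluing never produces `j`. [folklore] -/
theorem glue_ne (i j y : ℕ) (hij : i ≠ j) : glue i j y ≠ j := by
  unfold glue; split_ifs with h <;> [exact hij; exact h]

/-- Gluing stays inside `S ∖ {j}`. [folklore] -/
theorem glue_mem_erase {S : Finset ℕ} {i j y : ℕ} (hi : i ∈ S) (hij : i ≠ j) (hy : y ∈ S) :
    glue i j y ∈ S.erase j := by
  rw [Finset.mem_erase]
  refine ⟨glue_ne i j y hij, ?_⟩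
  unfold glue; split_ifs <;> assumption

/-- Both lifts are injective on `S` when `r₁` is injective on `S ∖ {j}`.
[Gryaznov–Ovcharov–Riazanov 2024, Lemma 3 (proof: displays (1), (2) are linear orders)]
[cite: GryaznovOvcharovRiazanov2024, Lemma 3] -/
theorem injOn_lifts {S : Finset ℕ} {r₁ : ℕ → ℕ} {i j : ℕ} (hr₁ : Set.InjOn r₁ (S.erase j : Finset ℕ)) :
    Set.InjOn (liftAfter r₁ i j) S ∧ Set.InjOn (liftBefore r₁ i j) S := by
  have key : ∀ {y y' : ℕ}, y ∈ S → y' ∈ S → y ≠ j → y' ≠ j → r₁ y = r₁ y' → y = y' :=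
    fun hy hy' hyj hy'j h => hr₁ (Finset.mem_erase.2 ⟨hyj, hy⟩) (Finset.mem_erase.2 ⟨hy'j, hy'⟩) h
  constructor
  · intro y hy y' hy' h
    unfold liftAfter at h
    by_cases hyj : y = j <;> by_cases hy'j : y' = j
    · rw [hyj, hy'j]
    · rw [if_pos hyj, if_neg hy'j] at h; omega
    · rw [if_neg hyj, if_pos hy'j] at h; omega
    · rw [if_neg hyj, if_neg hy'j] at h; exact key hy hy' hyj hy'j (by omega)
  · intro y hy y' hy' h
    unfold liftBefore at h
    by_cases hyj : y = j <;> by_cases hy'j : y' = j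
    · rw [hyj, hy'j]
    · rw [if_pos hyj, if_neg hy'j] at h; omega
    · rw [if_neg hyj, if_pos hy'j] at h; omega
    · rw [if_neg hyj, if_neg hy'j] at h; exact key hy hy' hyj hy'j (by omega)

/-- **The lifts realise the glued bits**: on every pair other than `(i, j)`, `(j, i)`, the comparison
bit under either lift equals the bit of the glued pair under `r₁` (`j` sits next to `i`, so it
compares with everybody else exactly as `i` does). [Gryaznov–Ovcharov–Riazanov 2024, Lemma 3 (proof:
"`τ^{(1)}` and `τ^{(2)}` … encodings as `ORDER_n`-proper solutions of `Bx = c`")]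
[cite: GryaznovOvcharovRiazanov2024, Lemma 3] -/
theorem cmpBit_lifts {S : Finset ℕ} {r₁ : ℕ → ℕ} {i j : ℕ} (hr₁ : Set.InjOn r₁ (S.erase j : Finset ℕ))
    (hi : i ∈ S) (hij : i ≠ j) {p : ℕ × ℕ} (h1 : p.1 ∈ S) (h2 : p.2 ∈ S) (hne : p.1 ≠ p.2)
    (hpij : p ≠ (i, j)) (hpji : p ≠ (j, i)) :
    cmpBit (liftAfter r₁ i j) p = cmpBit r₁ (gluePair i j p) ∧
      cmpBit (liftBefore r₁ i j) p = cmpBit r₁ (gluePair i j p) := by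
  have hiS' : i ∈ S.erase j := Finset.mem_erase.2 ⟨hij, hi⟩
  unfold cmpBit gluePair glue liftAfter liftBefore
  by_cases hp1 : p.1 = j <;> by_cases hp2 : p.2 = j
  · exact absurd (hp1.trans hp2.symm) hne
  · -- `p = (j, l)`, glued to `(i, l)` with `l ≠ i`
    have hli : p.2 ≠ i := fun h => hpji (Prod.ext hp1 h)
    have hne₁ : r₁ i ≠ r₁ p.2 := fun h =>
      hli (hr₁ (Finset.mem_erase.2 ⟨hp2, h2⟩) hiS' h.symm)
    simp only [hp1, if_true, hp2, if_false]
    constructor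
    · by_cases h : r₁ i < r₁ p.2
      · rw [if_pos h, if_pos (by omega)]
      · rw [if_neg h, if_neg (by omega)]
    · by_cases h : r₁ i < r₁ p.2
      · rw [if_pos h, if_pos (by omega)]
      · rw [if_neg h, if_neg (by omega)]
  · -- `p = (k, j)`, glued to `(k, i)` with `k ≠ i`
    have hki : p.1 ≠ i := fun h => hpij (Prod.ext h hp2)
    have hne₁ : r₁ p.1 ≠ r₁ i := fun h =>
      hki (hr₁ (Finset.mem_erase.2 ⟨hp1, h1⟩) hiS' h)
    simp only [hp1, if_false, hp2, if_true]
    constructor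
    · by_cases h : r₁ p.1 < r₁ i
      · rw [if_pos h, if_pos (by omega)]
      · rw [if_neg h, if_neg (by omega)]
    · by_cases h : r₁ p.1 < r₁ i
      · rw [if_pos h, if_pos (by omega)]
      · rw [if_neg h, if_neg (by omega)]
  · simp only [hp1, hp2, if_false]
    constructor
    · by_cases h : r₁ p.1 < r₁ p.2
      · rw [if_pos h, if_pos (by omega)]
      · rw [if_neg h, if_neg (by omega)]
    · by_cases h : r₁ p.1 < r₁ p.2
      · rw [if_pos h, if_pos (by omega)]
      · rw [if_neg h, if_neg (by omega)]

/-- The bit of `(i, j)` itself: `1` after, `0` before. [Gryaznov–Ovcharov–Riazanov 2024, Lemma 3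
(proof: "exactly one of them satisfies the equation `f(x) = α` since `x_{ij}` appears in it")]
[cite: GryaznovOvcharovRiazanov2024, Lemma 3] -/
theorem cmpBit_lifts_self (r₁ : ℕ → ℕ) {i j : ℕ} (hij : i ≠ j) :
    cmpBit (liftAfter r₁ i j) (i, j) = 1 ∧ cmpBit (liftBefore r₁ i j) (i, j) = 0 := by
  unfold cmpBit liftAfter liftBefore
  simp only [if_neg hij, if_true]
  constructor
  · rw [if_pos (by omega)]
  · rw [if_neg (by omega)]

end OrderParity

end Literature.Computability.MetaComplexity
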